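import Summits.BirchSwinnertonDyer.BirchSwinnertonDyer.Theorems.EisensteinPrimesMazurMCOnCellBTwistbackKatopointDoor
import Summits.BirchSwinnertonDyer.Rank1Residual.X2.RankOneNonsplitCertificate
import HarnessLib

/-!
# Crux 3 `MazurMCOnCellB` (stmt-BirchSwinnertonDyer-19033), line `twistback` v12 — λ-MINIMAL PARTNERS ARE CONNECTED PARTNERED
# VERTICES, AND THE `μ_an = 0` HALF OF EVERY `(μ_an, λ_an)` READING AT A PARTNER IS ALREADY PAID FOR BY THE CONE: Greenberg–Vatsal
# (conjunct 14 of `PublishedInputs`) gives `X2.AnalyticMuLE Wd p 0` at every Greenberg–Vatsal-parity multiplicative pair, in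
# particular at every twistback partner; hence the non-split `λ_an = 1` door and the split `λ_an = 2` doors (road (c), katopoint)
# into the RIGHT disjunct of the registered stub with ONE reading fewer

Successor LEAD seat `cruxlead-stmt-BirchSwinnertonDyer-19033` (gen 0; director-bsd RULING (316)(5)), cell `bsd-eis`,
2026-08-29. `--supports stmt-BirchSwinnertonDyer-19033 --as helper`; a helper under the END-STATE skeleton twistback v12
(sha256 540948e0…, RESHAPE #35; HELD). HONEST FRAMING: THEOREMS ONLY (no `def`, no named fact introduced, no `sorry`); every
theorem is CONDITIONAL on the named facts it lists — §1 on Greenberg–Vatsal's multiplicative Thm. (1.3)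
(`lambdaMu_multiplicative_of_gvPar`, PUBLISHED, flag `GV00-mult-asserted`: no numbered theorem of the source states the
multiplicative case) resp. on `PublishedInputs` (item -19037, whose conjunct 14 it is); §2–§3 on `PublishedInputs`, Disegni
2020 Thm. 4(1) (§2) and, in the Mazur-MC corollaries, the v12 cone (Poitou–Tate ×2 as hypotheses, Hsieh 2014, LZZ 2018, Mazur
Cor. 4.1, Keller–Yin Thm. D PREPRINT flag KYD-gap) — and on PER-PAIR READINGS at ONE partner taken as hypotheses
(`r_an(E^{(d_K)}) = 1`, `X2.AnalyticLambdaEq Wd p 1` resp. `2`, `X2.O9.ExceptionalLeadingTermAt Wd p` or the katopoint pair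
(R) `ExcRubinFormulaAt` ∧ (PR) `PerrinRiouUpToUnitAt PRRatio` — `@[conjecture]` nodes, OPEN at a split multiplicative prime
with `E[p]` reducible); closes no registered stub; no summit statement, no Mazur main conjecture and no case of BSD is proved
for any curve; 0 cells / labels / stubs / tiers move.

## Why

The per-pair doors into 6⁷'s right disjunct that read the two Iwasawa-invariant engines at a partner `Wd` — p640749 §3(ii)
(non-split, `(μ_an, λ_an) = (0, 1)`), p681006 §1 / `…TwistbackKatopointDoor` §2 (split, `(0, 2)` + the exceptional leading
term resp. (R) ∧ (PR)) — take `X2.AnalyticMuLE Wd p 0` as a reading; b2b's λ-minimality lemmas behind them are deliberately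
Greenberg–Vatsal-free. But every theorem of the twistback line already assumes `PublishedInputs`, whose conjunct 14 IS
Greenberg–Vatsal's multiplicative Thm. (1.3): at a multiplicative pair of GV parity (`p ≠ 2`) THE `p`-adic `L`-function
satisfies `ϖ·L = ι b` with `b ∈ Λ` of unit content — i.e. `μ_an = 0`, i.e. `X2.AnalyticMuLE · p 0` (§1, twelve lines:
one unit coefficient, `hasUnitContent_iff_exists_norm_coeff_map_eq_one`). A twistback partner `Wd` (minimal model of
`E^{(d_K)}`, `K` admissible, `p` split in `K`) of an X2b pair IS such a pair (`X2.classX2_twist`; the parity FLIPS: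
`gvPar_of_not_gvPar_of_twist`). So inside the cone the `μ`-reading is free and the doors need only `λ_an`. §2 also lands the
v12-currency form of the non-split λ-minimal road, which the tree had only in the v4–v7 «MC at the pair» shape
(`…OnePartnerAtCertificates.mazurMainConjectureAt_of_cellB_of_not_split_of_lamMin_twistAt`).

## What

* §1 `analyticMuLE_zero_of_gvPar_mult` (`hGV`; any multiplicative GV-parity pair, `p ≠ 2`), `analyticMuLE_zero_of_gvPar_mult_of_publishedInputs`
  (`hP`), `analyticMuLE_zero_partner` (at every minimal model of the twist of an X2b pair by an admissible `K`; `hP`).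
* §2 NON-split: `connectedPartner_of_not_split_of_lamOne` — `X2.CellB W p`, `p` NON-split, ONE admissible `K`, `r_an(E^{(d_K)}) = 1`,
  `X2.AnalyticLambdaEq Wd p 1` at every minimal model ⟹ the right disjunct of 6⁷ (§1 + p640749 §3(ii) + p679233 §3);
  `mazurMainConjectureAt_of_cellB_of_not_split_of_lamOne` — hence Mazur's MC at the pair (p679233 §1).
* §3 SPLIT: `connectedPartner_of_split_of_lamTwo_of_excLT_muFree` (p681006 §1 with the `μ`-reading discharged),
  `connectedPartner_of_split_of_lamTwo_of_katopoint_muFree` (`…TwistbackKatopointDoor` §2 likewise), and the Mazur-MC corollary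
  `mazurMainConjectureAt_of_cellB_of_split_of_lamTwo_of_katopoint_muFree`.

References: [GreenbergVatsal2000] Thm. (1.3), pp. 2–3 (1)–(2), pp. 14–15; [Wuthrich2014] Thm. 16; [SteinWuthrich2013] Thm. 6.1,
§4.2; [Disegni2020] §3.2 Thm. 4; [MazurTateTeitelbaum1986Invent] §II.10; [BurnsKuriharaSano2019] Conj. 2.8 (ii); [KellerYin2024]
Thm. D; tree: p640749, p679233, p681006, `…TwistbackKatopointDoor`, `X2/RankOneNonsplitCertificate.lean`,
`GreenbergVatsal2000/MultiplicativeReduction.lean`, `GreenbergVatsal2000/CongruentCurves.lean`.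
-/

set_option autoImplicit false

-- `Summit.BirchSwinnertonDyer.BirchSwinnertonDyer.…`: the summit and its single sub-problem share a name.
set_option linter.dupNamespace false

noncomputable section

open scoped Classical MatrixGroups ModularForm

open CongruenceSubgroup WeierstrassCurve NumberField IsDedekindDomain Field
  Literature.NumberTheory.EllipticCurves
  Literature.NumberTheory.GaloisRepresentations
  Literature.NumberTheory.EllipticCurves.ModularForms
  Literature.NumberTheory.QuadraticFields
  Literature.NumberTheory.EllipticCurves.Rank1Residual
  Literature.NumberTheory.EllipticCurves.Rank1Residual.Typed
  Literature.NumberTheory.EllipticCurves.Wuthrich2014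
  Literature.NumberTheory.EllipticCurves.SteinWuthrich2013
  Literature.NumberTheory.EllipticCurves.Disegni2020
  Literature.NumberTheory.EllipticCurves.GreenbergVatsal2000
  Literature.NumberTheory.EllipticCurves.KellerYin2024
  Literature.NumberTheory.GaloisCohomology
  Summit.BirchSwinnertonDyer.Rank1Residual
  Summit.BirchSwinnertonDyer.Rank1Residual.X2
  Summit.BirchSwinnertonDyer.BirchSwinnertonDyer.Theses
  Summit.BirchSwinnertonDyer.BirchSwinnertonDyer.Theorems.EisensteinPrimesMazurMCOnCellBTwistbackTwoStepDefs
  Summit.BirchSwinnertonDyer.BirchSwinnertonDyer.Theorems.EisensteinPrimesMazurMCOnCellBTwistbackConnectedPartnerZigzag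
  Summit.BirchSwinnertonDyer.BirchSwinnertonDyer.Theorems.EisensteinPrimesMazurMCOnCellBTwistbackConnectedPartnerDoors
  Summit.BirchSwinnertonDyer.BirchSwinnertonDyer.Theorems.EisensteinPrimesMazurMCOnCellBKatopointDefs
  Summit.BirchSwinnertonDyer.BirchSwinnertonDyer.Theorems.EisensteinPrimesMazurMCOnCellBTwistbackKatopointDoor

namespace Summit.BirchSwinnertonDyer.BirchSwinnertonDyer.Theorems.EisensteinPrimesMazurMCOnCellBTwistbackLamMinDoors

/-! ## §1. `μ_an = 0` at a multiplicative pair of Greenberg–Vatsal parity, from Greenberg–Vatsal Thm. (1.3) -/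

/-- **`μ_an = 0` at every MULTIPLICATIVE pair of Greenberg–Vatsal parity (`p ≠ 2`), from Greenberg–Vatsal's multiplicative
Thm. (1.3)** (`hGV` = `lambdaMu_multiplicative_of_gvPar`, PUBLISHED named fact, flag `GV00-mult-asserted`): for THE
multiplicative `p`-adic `L`-function `L` of the newform of `W` and the Néron normalisation `ϖ`, `ϖ·L = ι b` with `b ∈ Λ` of
unit content (§3 Thm. (3.11): `μ(L(G)) = 0` by Ferrero–Washington), so ONE coefficient of `ϖ·L` is a `p`-adic unit
(`hasUnitContent_iff_exists_norm_coeff_map_eq_one`), which is the typed certificate `X2.AnalyticMuLE W p 0` (some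
coefficient of norm `> p⁻¹`). The cyclotomic datum and a Selmer dual datum required by the fact's binders exist
(`exists_isCyclotomic_isTopGenerator_isCyclotomicVariable_holds`, `nonempty_selmerDualData_holds`). CONDITIONAL on `hGV`;
nothing is computed. [cite: GreenbergVatsal2000, Thm. (1.3) with pp. 14–15; p. 2 (2); §3 Thm. (3.11)]
[cite: Washington1997, §7.1] -/
theorem analyticMuLE_zero_of_gvPar_mult (hGV : lambdaMu_multiplicative_of_gvPar)
    (W : WeierstrassCurve ℚ) [W.IsElliptic] [W.IsGloballyMinimal] (p : ℕ) [Fact p.Prime] (hp2 : p ≠ 2)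
    (hmult : W.HasMultiplicativeReductionAtPrime p) (hpar : GVPar W p) :
    X2.AnalyticMuLE W p 0 := by
  intro N _ f hf ϖ hϖ L hLs hLn
  have hpP : p.Prime := Fact.out
  obtain ⟨κ, hκ, γ, hγ, hγ'⟩ := exists_isCyclotomic_isTopGenerator_isCyclotomicVariable_holds p
  obtain ⟨D⟩ := W.nonempty_selmerDualData_holds κ γ hγ
  obtain ⟨-, fE, -, -, hsplit, hnonsplit⟩ := hGV W p hp2 hmult hpar hκ hγ hγ' hf D ϖ hϖ
  have key : ∃ b : IwasawaAlgebra p,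
      iwasawaToPowerSeries p b = PowerSeries.C ((ϖ : ℚ) : ℚ_[p]) * L ∧ HasUnitContent b := by
    by_cases hs : W.HasSplitMultiplicativeReductionAtPrime p
    · obtain ⟨b, hb, hub, -⟩ := hsplit hs L (hLs hs)
      exact ⟨b, hb, hub⟩
    · obtain ⟨b, hb, hub, -⟩ := hnonsplit hs L (hLn hs)
      exact ⟨b, hb, hub⟩
  obtain ⟨b, hb, hub⟩ := key
  obtain ⟨n, hn⟩ := (hasUnitContent_iff_exists_norm_coeff_map_eq_one b).mp hub
  refine ⟨n, ?_⟩
  rw [← hb, hn, Nat.cast_zero, zero_add, zpow_neg, zpow_one]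
  exact inv_lt_one_of_one_lt₀ (by exact_mod_cast hpP.one_lt)

/-- **`μ_an = 0` at a multiplicative pair of Greenberg–Vatsal parity, from the route's `PublishedInputs`** (conjunct 14 =
Greenberg–Vatsal's multiplicative Thm. (1.3)). [cite: GreenbergVatsal2000, Thm. (1.3) with pp. 14–15; p. 2 (2)] -/
theorem analyticMuLE_zero_of_gvPar_mult_of_publishedInputs (hP : EisensteinPrimes.PublishedInputs)
    (W : WeierstrassCurve ℚ) [W.IsElliptic] [W.IsGloballyMinimal] (p : ℕ) [Fact p.Prime] (hp2 : p ≠ 2)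
    (hmult : W.HasMultiplicativeReductionAtPrime p) (hpar : GVPar W p) :
    X2.AnalyticMuLE W p 0 :=
  analyticMuLE_zero_of_gvPar_mult hP.2.2.2.2.2.2.2.2.2.2.2.2.2.1 W p hp2 hmult hpar

/-- **`μ_an = 0` at every twistback PARTNER, from `PublishedInputs`.** Data: an X2b pair `(W, p)` (`X2.CellB W p`: `p ≠ 2`
multiplicative, `E[p]` reducible, NOT of Greenberg–Vatsal parity), `K` imaginary quadratic with `p` split in `K`, and a
globally minimal model `Wd` of `E^{(d_K)}`. Then `Wd` is multiplicative at `p` with `E^{(d_K)}[p]` reducible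
(`X2.classX2_twist`) and of Greenberg–Vatsal parity — the parity FLIPS under the odd character `ε_K` unramified at `p`
(`gvPar_of_not_gvPar_of_twist`, `not_dvd_discr_of_split`) —, so §1 applies. CONDITIONAL on `PublishedInputs` (its
Greenberg–Vatsal conjunct); no reading is consumed. [cite: GreenbergVatsal2000, Thm. (1.3) with pp. 1, 14–15; p. 2 (2)] -/
theorem analyticMuLE_zero_partner (hP : EisensteinPrimes.PublishedInputs)
    (W : WeierstrassCurve ℚ) [W.IsElliptic] [W.IsGloballyMinimal] (p : ℕ) [Fact p.Prime] (hc : X2.CellB W p)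
    (K : Type) [Field K] [NumberField K] (hK : IsImaginaryQuadratic K) (hHp : SatisfiesHeegnerHypothesis p K)
    (Wd : WeierstrassCurve ℚ) [Wd.IsElliptic] [Wd.IsGloballyMinimal]
    (hWd : ∃ C : VariableChange ℚ, C • Wd = W.quadraticTwist (NumberField.discr K : ℚ)) :
    X2.AnalyticMuLE Wd p 0 := by
  have hp : p.Prime := Fact.out
  obtain ⟨_, hX, hnot⟩ := hc
  obtain ⟨hp2, hred, hmult⟩ := hX
  obtain ⟨C, hC⟩ := hWd
  have hdneg : NumberField.discr K < 0 := IsImaginaryQuadratic.discr_neg hK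
  have hpd : ¬ (p : ℤ) ∣ NumberField.discr K := not_dvd_discr_of_split hK hp hp2 hHp
  have hXd : ClassX2 Wd p := X2.classX2_twist W p ⟨hp2, hred, hmult⟩ K hK hHp Wd ⟨C, hC⟩
  have hgv : GVPar Wd p :=
    gvPar_of_not_gvPar_of_twist (W := W) (p := p) hp2 hred hnot hdneg hpd Wd C (by simpa using hC)
  intro N _ f hf ϖ hϖ L hLs hLn
  exact analyticMuLE_zero_of_gvPar_mult_of_publishedInputs hP Wd p hp2 hXd.2.2 hgv f hf ϖ hϖ L hLs hLn

/-! ## §2. NON-split: a λ-minimal partner (`λ_an = 1`) is a connected partnered vertex -/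

/-- **NON-SPLIT X2b PAIR, ONE λ-MINIMAL PARTNER ⟹ the right disjunct of the v12 stub.** Data: `X2.CellB W p` with `p`
NON-split for `W`; `K` imaginary quadratic, Heegner for `N_W` and `p`, `d_K` odd `< −4`; the reading
`ord_{s=1} L(E^{(d_K)}, s) = 1`; and at every globally minimal model `Wd` of `E^{(d_K)}` the reading `X2.AnalyticLambdaEq Wd p 1`
(`λ_an = 1` for THE non-split Mazur–Tate–Teitelbaum function). Each `Wd` is X2c (`X2.classX2_twist`, `analyticRank_smul`) and
NON-split at `p` (`X2.not_hasSplitMultiplicativeReductionAtPrime_of_smul_eq_quadraticTwist`); its `μ`-reading is free (§1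
`analyticMuLE_zero_partner`), so LEAD g9's p640749 §3(ii) `missingUpperBoundAt_of_cellC_of_not_split_of_lamMin` (b2b's
λ-squeeze: Kato–Wuthrich divisibility gives Mazur's MC at `Wd` AND Schneider's non-degeneracy; Disegni Thm. 4(1) and
Stein–Wuthrich the leading terms) gives the upper half at `Wd`; `connectedPartner_of_partnerAt` packages the partner AT `W`
(empty zig-zag). CONDITIONAL on `PublishedInputs`, Disegni 2020 Thm. 4(1) and the per-pair readings; the v11 order-one anchor
(p679233 §2) is the same exit in `ord_{T=0}`-currency. [cite: Disegni2020, Thm. 4 (§3.2)] [cite: SteinWuthrich2013, Thm. 6.1 (p. 20), §4.2]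
[cite: Wuthrich2014, Thm. 16 (p. 397)] [cite: GreenbergVatsal2000, Thm. (1.3); p. 4 (λ-invariants)] -/
theorem connectedPartner_of_not_split_of_lamOne (hP : EisensteinPrimes.PublishedInputs)
    (hDis : padicBSD_rankOne_nonsplitMult)
    (W : WeierstrassCurve ℚ) [W.IsElliptic] [W.IsGloballyMinimal] (p : ℕ) [Fact p.Prime]
    (hc : X2.CellB W p) (hns : ¬ W.HasSplitMultiplicativeReductionAtPrime p)
    (K : Type) [Field K] [NumberField K] (hK : IsImaginaryQuadratic K)
    (hHN : SatisfiesHeegnerHypothesis (W.conductorNorm ℤ) K) (hHp : SatisfiesHeegnerHypothesis p K)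
    (hodd : Odd (NumberField.discr K)) (hlt : NumberField.discr K < -4)
    (hr1 : (W.quadraticTwist (NumberField.discr K : ℚ)).analyticRank = 1)
    (hcert : ∀ (Wd : WeierstrassCurve ℚ) [Wd.IsElliptic] [Wd.IsGloballyMinimal],
      (∃ C : VariableChange ℚ, C • Wd = W.quadraticTwist (NumberField.discr K : ℚ)) → X2.AnalyticLambdaEq Wd p 1) :
    ∃ (W₁ : WeierstrassCurve ℚ) (_ : W₁.IsElliptic) (_ : W₁.IsGloballyMinimal)
      (U : WeierstrassCurve ℚ) (_ : U.IsElliptic) (_ : U.IsGloballyMinimal)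
      (W₀ : WeierstrassCurve ℚ) (_ : W₀.IsElliptic) (_ : W₀.IsGloballyMinimal),
      IsIsogenous W W₁ ∧
      Relation.ReflTransGen (fun A B : WeierstrassCurve ℚ ↦ TwoStepAt p A B ∨
        (TwoStepAt p B A ∧ ∃ (_ : B.IsElliptic) (_ : B.IsGloballyMinimal), X2.CellB B p)) W₁ U ∧
      IsIsogenous U W₀ ∧
      ∃ (K : Type) (_ : Field K) (_ : NumberField K), IsImaginaryQuadratic K ∧
        SatisfiesHeegnerHypothesis (W₀.conductorNorm ℤ) K ∧ SatisfiesHeegnerHypothesis p K ∧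
        Odd (NumberField.discr K) ∧ NumberField.discr K < -4 ∧
        (W₀.quadraticTwist (NumberField.discr K : ℚ)).analyticRank = 1 ∧
        ∀ (Wd : WeierstrassCurve ℚ) [Wd.IsElliptic] [Wd.IsGloballyMinimal],
          (∃ C : VariableChange ℚ, C • Wd = W₀.quadraticTwist (NumberField.discr K : ℚ)) →
          MissingUpperBoundAt Wd p := by
  have hp2 : p ≠ 2 := hc.2.1.1
  have hmult : W.HasMultiplicativeReductionAtPrime p := hc.2.1.2.2
  refine connectedPartner_of_partnerAt W ⟨K, inferInstance, inferInstance, hK, hHN, hHp, hodd, hlt, hr1, ?_⟩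
  intro Wd _ _ hWd
  obtain ⟨C, hC⟩ := hWd
  have hXd : ClassX2 Wd p := X2.classX2_twist W p hc.2.1 K hK hHp Wd ⟨C, hC⟩
  have hnsd : ¬ Wd.HasSplitMultiplicativeReductionAtPrime p :=
    X2.not_hasSplitMultiplicativeReductionAtPrime_of_smul_eq_quadraticTwist W Wd hK p hp2 hmult hns hHp hC
  have hrd : Wd.analyticRank = 1 := by
    have h := congrArg WeierstrassCurve.analyticRank hC
    rw [analyticRank_smul] at h
    rw [h, hr1]
  exact EisensteinPrimesMazurMCOnCellBTwistbackOnePartnerCertificates.missingUpperBoundAt_of_cellC_of_not_split_of_lamMin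
    hP hDis Wd p ⟨hrd, hXd⟩ hnsd (analyticMuLE_zero_partner hP W p hc K hK hHp Wd ⟨C, hC⟩) (hcert Wd ⟨C, hC⟩)

/-- **Mazur's main conjecture at a NON-split X2b pair from ONE λ-minimal partner (`λ_an = 1` at every minimal model of
ONE admissible twist)** — §2 then p679233 §1 `mazurMainConjectureAt_of_cellB_of_connectedPartner`. Named facts BY NAME:
`PublishedInputs`, Disegni Thm. 4(1), Poitou–Tate ×2 (hypotheses; tree theorems), Hsieh, LZZ, Mazur Cor. 4.1, Keller–Yin
Thm. D (PRE) — the v12 cone. CONDITIONAL; per pair this is the v4-era exit of `…OnePartnerAtCertificates` §2 re-issued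
through the v12 right disjunct (so it propagates along zig-zags and isogenies by F2g with no further certificate).
[claim: KellerYin2024, status: under-review] [cite: KellerYin2024, Thm. D = Thm. 5.1.3] [cite: Disegni2020, Thm. 4 (§3.2)]
[cite: SteinWuthrich2013, Thm. 6.1 (p. 20), §4.2] [cite: Miller2011LMS, Def. 1.1] -/
theorem mazurMainConjectureAt_of_cellB_of_not_split_of_lamOne (hP : EisensteinPrimes.PublishedInputs)
    (hDis : padicBSD_rankOne_nonsplitMult)
    (hPT : ∀ (K : Type) [Field K] [NumberField K], poitouTate_selmerStructure_duality K)
    (hPT2 : ∀ (K : Type) [Field K] [NumberField K], poitouTate_sha_tateDual K)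
    (hH : hsieh2014_exists_anticyclotomicPAdicLFunction)
    (hF : LiuZhangZhang2018.thm151_thm153_modularCurve_heegnerVector) (hMaz : mazur_not_dvd_maninConstant_of_odd)
    (hD : KellerYin2024.thmD_imcMult_exists_isBDPLFunction_isTorsion_charIdeal_eq_OPEN)
    (W : WeierstrassCurve ℚ) [W.IsElliptic] [W.IsGloballyMinimal] (p : ℕ) [Fact p.Prime]
    (hc : X2.CellB W p) (hns : ¬ W.HasSplitMultiplicativeReductionAtPrime p)
    (K : Type) [Field K] [NumberField K] (hK : IsImaginaryQuadratic K)
    (hHN : SatisfiesHeegnerHypothesis (W.conductorNorm ℤ) K) (hHp : SatisfiesHeegnerHypothesis p K)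
    (hodd : Odd (NumberField.discr K)) (hlt : NumberField.discr K < -4)
    (hr1 : (W.quadraticTwist (NumberField.discr K : ℚ)).analyticRank = 1)
    (hcert : ∀ (Wd : WeierstrassCurve ℚ) [Wd.IsElliptic] [Wd.IsGloballyMinimal],
      (∃ C : VariableChange ℚ, C • Wd = W.quadraticTwist (NumberField.discr K : ℚ)) → X2.AnalyticLambdaEq Wd p 1) :
    X2.MazurMainConjectureAt W p :=
  mazurMainConjectureAt_of_cellB_of_connectedPartner hP hPT hPT2 hH hF hMaz hD W p hc
    (connectedPartner_of_not_split_of_lamOne hP hDis W p hc hns K hK hHN hHp hodd hlt hr1 hcert)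

/-! ## §3. SPLIT: the `(0, 2)` doors with the `μ`-reading discharged -/

/-- **ROAD (c) AT A SPLIT X2b PAIR, `μ`-FREE ⟹ the right disjunct of the v12 stub**: LEAD g15's p681006 §1
`connectedPartner_of_split_of_lamTwo_of_excLT` with the reading `X2.AnalyticMuLE Wd p 0` DISCHARGED by §1 (Greenberg–Vatsal,
inside `PublishedInputs`); what remains per partner is `X2.AnalyticLambdaEq Wd p 2` and the typed exceptional leading term
`X2.O9.ExceptionalLeadingTermAt Wd p` (OPEN in print for reducible `E[p]`). CONDITIONAL on `PublishedInputs` and on those readings.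
[cite: MazurTateTeitelbaum1986Invent, §II.10 (hypothesis)] [cite: SteinWuthrich2013, Thm. 6.1 (p. 20), §4.2]
[cite: GreenbergVatsal2000, Thm. (1.3) with pp. 14–15; p. 2 (2)] -/
theorem connectedPartner_of_split_of_lamTwo_of_excLT_muFree (hP : EisensteinPrimes.PublishedInputs)
    (W : WeierstrassCurve ℚ) [W.IsElliptic] [W.IsGloballyMinimal] (p : ℕ) [Fact p.Prime]
    (hc : X2.CellB W p) (hsplit : W.HasSplitMultiplicativeReductionAtPrime p)
    (K : Type) [Field K] [NumberField K] (hK : IsImaginaryQuadratic K)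
    (hHN : SatisfiesHeegnerHypothesis (W.conductorNorm ℤ) K) (hHp : SatisfiesHeegnerHypothesis p K)
    (hodd : Odd (NumberField.discr K)) (hlt : NumberField.discr K < -4)
    (hr1 : (W.quadraticTwist (NumberField.discr K : ℚ)).analyticRank = 1)
    (hcert : ∀ (Wd : WeierstrassCurve ℚ) [Wd.IsElliptic] [Wd.IsGloballyMinimal],
      (∃ C : VariableChange ℚ, C • Wd = W.quadraticTwist (NumberField.discr K : ℚ)) →
      X2.AnalyticLambdaEq Wd p 2 ∧ X2.O9.ExceptionalLeadingTermAt Wd p) :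
    ∃ (W₁ : WeierstrassCurve ℚ) (_ : W₁.IsElliptic) (_ : W₁.IsGloballyMinimal)
      (U : WeierstrassCurve ℚ) (_ : U.IsElliptic) (_ : U.IsGloballyMinimal)
      (W₀ : WeierstrassCurve ℚ) (_ : W₀.IsElliptic) (_ : W₀.IsGloballyMinimal),
      IsIsogenous W W₁ ∧
      Relation.ReflTransGen (fun A B : WeierstrassCurve ℚ ↦ TwoStepAt p A B ∨
        (TwoStepAt p B A ∧ ∃ (_ : B.IsElliptic) (_ : B.IsGloballyMinimal), X2.CellB B p)) W₁ U ∧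
      IsIsogenous U W₀ ∧
      ∃ (K : Type) (_ : Field K) (_ : NumberField K), IsImaginaryQuadratic K ∧
        SatisfiesHeegnerHypothesis (W₀.conductorNorm ℤ) K ∧ SatisfiesHeegnerHypothesis p K ∧
        Odd (NumberField.discr K) ∧ NumberField.discr K < -4 ∧
        (W₀.quadraticTwist (NumberField.discr K : ℚ)).analyticRank = 1 ∧
        ∀ (Wd : WeierstrassCurve ℚ) [Wd.IsElliptic] [Wd.IsGloballyMinimal],
          (∃ C : VariableChange ℚ, C • Wd = W₀.quadraticTwist (NumberField.discr K : ℚ)) →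
          MissingUpperBoundAt Wd p := by
  refine connectedPartner_of_split_of_lamTwo_of_excLT hP W p hc hsplit K hK hHN hHp hodd hlt hr1 ?_
  intro Wd _ _ hWd
  obtain ⟨hlam, hExc⟩ := hcert Wd hWd
  exact ⟨analyticMuLE_zero_partner hP W p hc K hK hHp Wd hWd, hlam, hExc⟩

/-- **KATO-POINT ROAD AT A SPLIT X2b PAIR, `μ`-FREE ⟹ the right disjunct of the v12 stub**: `…TwistbackKatopointDoor` §2
`connectedPartner_of_split_of_lamTwo_of_katopoint` with the reading `X2.AnalyticMuLE Wd p 0` DISCHARGED by §1; what remains per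
partner is `X2.AnalyticLambdaEq Wd p 2`, (R) `ExcRubinFormulaAt Wd p` and (PR) `Additive.PerrinRiouUpToUnitAt Kato2004.PRRatio Wd p`
(both `@[conjecture]` nodes, OPEN at a split multiplicative prime with `E[p]` reducible). CONDITIONAL on `PublishedInputs` and
on those readings. [cite: MazurTateTeitelbaum1986Invent, §II.10 (hypothesis)] [cite: BurnsKuriharaSano2019, Conj. 2.8 (ii) (p. 10) (hypothesis)]
[cite: GreenbergVatsal2000, Thm. (1.3) with pp. 14–15; p. 2 (2)] -/
theorem connectedPartner_of_split_of_lamTwo_of_katopoint_muFree (hP : EisensteinPrimes.PublishedInputs)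
    (W : WeierstrassCurve ℚ) [W.IsElliptic] [W.IsGloballyMinimal] (p : ℕ) [Fact p.Prime]
    (hc : X2.CellB W p) (hsplit : W.HasSplitMultiplicativeReductionAtPrime p)
    (K : Type) [Field K] [NumberField K] (hK : IsImaginaryQuadratic K)
    (hHN : SatisfiesHeegnerHypothesis (W.conductorNorm ℤ) K) (hHp : SatisfiesHeegnerHypothesis p K)
    (hodd : Odd (NumberField.discr K)) (hlt : NumberField.discr K < -4)
    (hr1 : (W.quadraticTwist (NumberField.discr K : ℚ)).analyticRank = 1)
    (hcert : ∀ (Wd : WeierstrassCurve ℚ) [Wd.IsElliptic] [Wd.IsGloballyMinimal],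
      (∃ C : VariableChange ℚ, C • Wd = W.quadraticTwist (NumberField.discr K : ℚ)) →
      X2.AnalyticLambdaEq Wd p 2 ∧ ExcRubinFormulaAt Wd p ∧ Additive.PerrinRiouUpToUnitAt Kato2004.PRRatio Wd p) :
    ∃ (W₁ : WeierstrassCurve ℚ) (_ : W₁.IsElliptic) (_ : W₁.IsGloballyMinimal)
      (U : WeierstrassCurve ℚ) (_ : U.IsElliptic) (_ : U.IsGloballyMinimal)
      (W₀ : WeierstrassCurve ℚ) (_ : W₀.IsElliptic) (_ : W₀.IsGloballyMinimal),
      IsIsogenous W W₁ ∧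
      Relation.ReflTransGen (fun A B : WeierstrassCurve ℚ ↦ TwoStepAt p A B ∨
        (TwoStepAt p B A ∧ ∃ (_ : B.IsElliptic) (_ : B.IsGloballyMinimal), X2.CellB B p)) W₁ U ∧
      IsIsogenous U W₀ ∧
      ∃ (K : Type) (_ : Field K) (_ : NumberField K), IsImaginaryQuadratic K ∧
        SatisfiesHeegnerHypothesis (W₀.conductorNorm ℤ) K ∧ SatisfiesHeegnerHypothesis p K ∧
        Odd (NumberField.discr K) ∧ NumberField.discr K < -4 ∧
        (W₀.quadraticTwist (NumberField.discr K : ℚ)).analyticRank = 1 ∧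
        ∀ (Wd : WeierstrassCurve ℚ) [Wd.IsElliptic] [Wd.IsGloballyMinimal],
          (∃ C : VariableChange ℚ, C • Wd = W₀.quadraticTwist (NumberField.discr K : ℚ)) →
          MissingUpperBoundAt Wd p := by
  refine connectedPartner_of_split_of_lamTwo_of_katopoint hP W p hc hsplit K hK hHN hHp hodd hlt hr1 ?_
  intro Wd _ _ hWd
  obtain ⟨hlam, hRub, hPR⟩ := hcert Wd hWd
  exact ⟨analyticMuLE_zero_partner hP W p hc K hK hHp Wd hWd, hlam, hRub, hPR⟩

/-- **Mazur's main conjecture at a SPLIT X2b pair from `λ_an = 2` + the katopoint readings at ONE admissible partner, `μ`-free**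
— `connectedPartner_of_split_of_lamTwo_of_katopoint_muFree` then p679233 §1. Named facts BY NAME: `PublishedInputs`, Poitou–Tate ×2
(hypotheses; tree theorems), Hsieh, LZZ, Mazur Cor. 4.1, Keller–Yin Thm. D (PRE) — the v12 cone. CONDITIONAL; (R)/(PR) are OPEN
conjecture nodes; nothing is closed class-wide and no cell moves by this theorem alone. [claim: KellerYin2024, status: under-review]
[cite: KellerYin2024, Thm. D = Thm. 5.1.3] [cite: MazurTateTeitelbaum1986Invent, §II.10 (hypothesis)]
[cite: BurnsKuriharaSano2019, Conj. 2.8 (ii) (p. 10) (hypothesis)] [cite: Miller2011LMS, Def. 1.1] -/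
theorem mazurMainConjectureAt_of_cellB_of_split_of_lamTwo_of_katopoint_muFree (hP : EisensteinPrimes.PublishedInputs)
    (hPT : ∀ (K : Type) [Field K] [NumberField K], poitouTate_selmerStructure_duality K)
    (hPT2 : ∀ (K : Type) [Field K] [NumberField K], poitouTate_sha_tateDual K)
    (hH : hsieh2014_exists_anticyclotomicPAdicLFunction)
    (hF : LiuZhangZhang2018.thm151_thm153_modularCurve_heegnerVector) (hMaz : mazur_not_dvd_maninConstant_of_odd)
    (hD : KellerYin2024.thmD_imcMult_exists_isBDPLFunction_isTorsion_charIdeal_eq_OPEN)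
    (W : WeierstrassCurve ℚ) [W.IsElliptic] [W.IsGloballyMinimal] (p : ℕ) [Fact p.Prime]
    (hc : X2.CellB W p) (hsplit : W.HasSplitMultiplicativeReductionAtPrime p)
    (K : Type) [Field K] [NumberField K] (hK : IsImaginaryQuadratic K)
    (hHN : SatisfiesHeegnerHypothesis (W.conductorNorm ℤ) K) (hHp : SatisfiesHeegnerHypothesis p K)
    (hodd : Odd (NumberField.discr K)) (hlt : NumberField.discr K < -4)
    (hr1 : (W.quadraticTwist (NumberField.discr K : ℚ)).analyticRank = 1)
    (hcert : ∀ (Wd : WeierstrassCurve ℚ) [Wd.IsElliptic] [Wd.IsGloballyMinimal],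
      (∃ C : VariableChange ℚ, C • Wd = W.quadraticTwist (NumberField.discr K : ℚ)) →
      X2.AnalyticLambdaEq Wd p 2 ∧ ExcRubinFormulaAt Wd p ∧ Additive.PerrinRiouUpToUnitAt Kato2004.PRRatio Wd p) :
    X2.MazurMainConjectureAt W p :=
  mazurMainConjectureAt_of_cellB_of_connectedPartner hP hPT hPT2 hH hF hMaz hD W p hc
    (connectedPartner_of_split_of_lamTwo_of_katopoint_muFree hP W p hc hsplit K hK hHN hHp hodd hlt hr1 hcert)

end Summit.BirchSwinnertonDyer.BirchSwinnertonDyer.Theorems.EisensteinPrimesMazurMCOnCellBTwistbackLamMinDoors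

end
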